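import Literature.NumberTheory.Automorphic.UnitaryGroupTruncatedKernelHighCusp        -- ★ `pseudoEisenstein_eq_self_of_forall_not_mem` (N-generic), `truncation_rational_mul`, N = 3 big cell
import Literature.NumberTheory.Automorphic.UnitaryGroupBorelHeightBigCellTwo          -- ★ N = 2 big cell `borelHeight_mul_borelHeight_le_one_of_not_mem_arithmeticBorel_two`
import Literature.NumberTheory.Automorphic.UnitaryGroupTruncatedKernelMeasurable      -- ★ Borel descent kit (`measurable_quotient_iff`, `isClosed_quotientSubgroup_quasiSplit`), `quotFun`
import Mathlib.MeasureTheory.Function.LpSeminorm.CompareExp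
import HarnessLib

/-!
# h413 ∕ Track B «K2-LIT», page EIS-RANK-ONE, rung R6e — `K2E1TruncatedEisensteinL2`: Arthur's truncation `Λ^T φ` of an automorphic function is BOUNDED on
# `G(𝔸)`, hence square-integrable on the automorphic quotient — hypothesis-first, `N`-generic over Mok's `quasiSplit F E c N`

Cell `pub/hodgecm-mathlib`, crux H413 = `stmt-HodgeConjecture-24833` (supports-only helper, count-neutral), route `HCCMUnconditional`; dealer K2E1-plan (g3),
SPEC `K2/K2E1-plan/g3/SPEC-EIS-R6-MaassSelberg.K2E1-plan-g3.md` §2 R6e; deal 2026-09-04T04:59:38Z → K2E4-p10 (g3).  THEOREMS ONLY (no `def`, no `instance`, no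
`notation`, no named-fact hypothesis, no `sorry`).

## What is proved (and what is NOT)

The only `L²` input of the Maass–Selberg relations is «`Λ^T E(f_z) ∈ L²(G(F)∖G(𝔸))`, locally uniformly in `z`».  This file isolates the SOFT part of that statement,
for ANY function `φ` on `G(𝔸) = U(J_N)(𝔸_F)` (Eisenstein series, residues, cusp forms alike), with every analytic input a named hypothesis:

* §1 **the case split** (`norm_truncation_le_of_cover`): if `G(F)·𝔖 = G(𝔸)` (`hcov`, the matrix of ★ `ReductionTheoryU`), `Λ^T φ` is left-`G(F)`-invariant (`hinv`),
  `‖φ‖ ≤ M₀` on the low part `𝔖 ∩ {H ≤ T}` (`hlow`) and `‖Λ^T φ‖ ≤ M₁` on the Siegel region `{H > T}` (`hhigh`), then `‖Λ^T φ‖ ≤ max M₀ M₁` EVERYWHERE.  The one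
  idea: a point `s` none of whose `G(F)`-translates is higher than `T` carries NO cut-off term, so `Λ^T φ(s) = φ(s)` (`truncation_apply_eq_self_of_forall_borelHeight_le`);
  any other point is moved into `{H > T}` by `hinv`.  No `T ≥ 1`, no topology, no measure theory.
* §2 **discharges of `hlow`**: from continuity on a compact set containing the low part (`exists_bound_low_of_isCompact`), or from moderate growth on `𝔖`
  (`exists_bound_low_of_moderateGrowth`).
* §3 **discharges of `hinv`, `hhigh` in `F`-rank one** (`1 ≤ T`, rank-one big cell `hSiegel : H(γ g)·H(g) ≤ 1` off `B(F)` — ★ at `N = 3`, `N = 2`): for left-`G(F)`-invariant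
  `φ`, a Haar measure `ν` of `N(𝔸_F)` and a fundamental domain `𝓕` of `N(F)`, `Λ^T φ` is left-`G(F)`-invariant (★ `truncation_rational_mul`) and
  `Λ^T φ = φ − φ_B` on `{H > T}` (`truncation_eq_self_sub_borelConstantTerm_of_siegel`, `N`-generic form of ★ `truncation_eq_self_sub_borelConstantTerm`); hence
  **`norm_truncation_le_of_rational_invariant`**: `hcov` + `hlow` + `hdec : ‖φ − φ_B‖ ≤ M₁ on {H > T}` ⟹ `‖Λ^T φ‖ ≤ max M₀ M₁`, with the `U(J₃)` ∕ `U(J₂)` instances.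
* §4 **`L²` on the automorphic quotient** (`memLp_quotFun_of_bound`, `memLp_two_quotFun_truncation_of_rational_invariant`): a bounded function whose descent
  `[g] ↦ Λ^T φ(g̃⁻¹)` (★ `AdelicGroupData.quotFun`) is a.e.-strongly measurable lies in every `L^p` of a finite measure (Mathlib `MemLp.of_bound`); and the Borel
  descent `measurable_quotFun_of_measurable` (`N`-generic form of ★ `measurable_quotFun_truncatedKernel`) reduces that measurability to measurability of `Λ^T φ` on `G(𝔸)`.
* §5 **families**: the constants are explicit (`max M₀ M₁`), so uniformity on any parameter set `Z` is inherited verbatim (`norm_truncation_le_of_cover_family`) — this is the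
  «locally uniform in `z`» clause R6g needs.

NOT proved here (named hypotheses, paid elsewhere on the EIS-RANK-ONE page): `hcov` = reduction theory (★ `K2E1ReductionTheoryU3` ∕ `U2` through ★ `quasiSplit_eq_cmDatum_of`);
`hlow` = continuity ∕ moderate growth of `φ = E(f_z)` (R4) plus relative compactness of the low part of the Siegel set; `hdec` = decay of `E − E_B` on `{H > T}` (R6d, Poisson
summation); measurability of `Λ^T E(f)` on `G(𝔸)` (R6b's two-`tsum` form over the countable `B(F)∖G(F)`).

HONEST LABEL.  Count-neutral helper; proves no printed statement; HC_CM is proved only modulo the 7 printed citations (2 remaining named inputs: hLiu418 =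
`stmt-HodgeConjecture-24832`, h413 = `stmt-HodgeConjecture-24833`) until rung 0 closes.

## References
* [MoeglinWaldspurger1995] C. Mœglin, J.-L. Waldspurger, *Spectral decomposition and Eisenstein series* (1995), I.2.13 (truncation on Siegel sets), IV.2.
* [Garrett2018] P. Garrett, *Modern Analysis of Automorphic Forms by Example* 1 (2018), §1.11, §2.10–§2.11.
* [Arthur1980] J. Arthur, *A trace formula for reductive groups II*, Compositio Math. 40 (1980), §1 (Lemma 1.4: `Λ^T φ` rapidly decreasing).
-/

set_option autoImplicit false
set_option linter.dupNamespace false  -- the mandated namespace repeats the summit's segment (`HodgeConjecture.HodgeConjecture`)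

noncomputable section

open MeasureTheory Measure NumberField IsDedekindDomain Set
open Literature.NumberTheory.Automorphic Literature.NumberTheory.Automorphic.UnitaryGroup
open scoped NNReal ENNReal Pointwise MatrixGroups

namespace Summit.HodgeConjecture.HodgeConjecture.Cruxes.H413.K2E1TruncatedEisensteinL2

variable {F E : Type} [Field F] [NumberField F] [Field E] [NumberField E] [Algebra F E] {c : E ≃ₐ[F] E} {N : ℕ} [NeZero N]

/-! ## §1 The case split: bounded below `T` on a covering set + bounded above `T` ⟹ bounded everywhere -/

section CaseSplit

variable [MeasurableSpace (adelicUnipotent F E c N)]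

/-- **A point with no `G(F)`-translate above the cut-off carries no truncation term**: if `H(δ s) ≤ T` for every `δ ∈ G(F)`, then `Λ^T φ(s) = φ(s)` (every term
`c_B^T φ(δ s)` of `Ψ(c_B^T φ)(s)` vanishes, ★ `constantTermTail_of_not_lt`).  Any `ν`, `𝓕`, `T`, `φ`. [cite: Garrett2018, §2.10 (PDF p. 119)] -/
theorem truncation_apply_eq_self_of_forall_borelHeight_le (ν : Measure (adelicUnipotent F E c N)) (𝓕 : Set (adelicUnipotent F E c N)) {T : ℝ≥0}
    (φ : (quasiSplit F E c N).Adelic → ℂ) {s : (quasiSplit F E c N).Adelic}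
    (h : ∀ δ : (quasiSplit F E c N).arithmeticSubgroup, borelHeight ((δ : (quasiSplit F E c N).Adelic) * s) ≤ T) :
    truncation ν 𝓕 T φ s = φ s := by
  rw [truncation_def, pseudoEisenstein_def]
  have h0 : ∀ q : Quotient (QuotientGroup.rightRel (arithmeticBorel F E c N)),
      constantTermTail ν 𝓕 T φ (((q.out : (quasiSplit F E c N).arithmeticSubgroup) : (quasiSplit F E c N).Adelic) * s) = 0 :=
    fun q => constantTermTail_of_not_lt φ (not_lt.2 (h q.out))
  simp only [h0, finsum_zero, sub_zero]

/-- **THE CASE SPLIT** (see the module docstring): `G(F)·𝔖 = G(𝔸)`, `Λ^T φ` left-`G(F)`-invariant, `‖φ‖ ≤ M₀` on `𝔖 ∩ {H ≤ T}`, `‖Λ^T φ‖ ≤ M₁` on `{H > T}`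
⟹ `‖Λ^T φ‖ ≤ max M₀ M₁` on all of `G(𝔸)`.  No `T ≥ 1`, no topology, no measure theory. [cite: MoeglinWaldspurger1995, I.2.13] [cite: Garrett2018, §2.10–§2.11] -/
theorem norm_truncation_le_of_cover {ν : Measure (adelicUnipotent F E c N)} {𝓕 : Set (adelicUnipotent F E c N)} {T : ℝ≥0}
    {φ : (quasiSplit F E c N).Adelic → ℂ} {𝔖 : Set (quasiSplit F E c N).Adelic} {M₀ M₁ : ℝ}
    (hcov : ((quasiSplit F E c N).arithmeticSubgroup : Set (quasiSplit F E c N).Adelic) * 𝔖 = Set.univ)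
    (hinv : ∀ (γ : (quasiSplit F E c N).arithmeticSubgroup) (g : (quasiSplit F E c N).Adelic),
      truncation ν 𝓕 T φ ((γ : (quasiSplit F E c N).Adelic) * g) = truncation ν 𝓕 T φ g)
    (hlow : ∀ s ∈ 𝔖, borelHeight s ≤ T → ‖φ s‖ ≤ M₀)
    (hhigh : ∀ g : (quasiSplit F E c N).Adelic, T < borelHeight g → ‖truncation ν 𝓕 T φ g‖ ≤ M₁)
    (g : (quasiSplit F E c N).Adelic) : ‖truncation ν 𝓕 T φ g‖ ≤ max M₀ M₁ := by
  have hg : g ∈ ((quasiSplit F E c N).arithmeticSubgroup : Set (quasiSplit F E c N).Adelic) * 𝔖 := by rw [hcov]; exact Set.mem_univ g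
  obtain ⟨γ, hγ, s, hs, rfl⟩ := Set.mem_mul.1 hg
  rw [show γ * s = ((⟨γ, hγ⟩ : (quasiSplit F E c N).arithmeticSubgroup) : (quasiSplit F E c N).Adelic) * s from rfl, hinv]
  by_cases hex : ∃ δ : (quasiSplit F E c N).arithmeticSubgroup, T < borelHeight ((δ : (quasiSplit F E c N).Adelic) * s)
  · obtain ⟨δ, hδ⟩ := hex
    rw [← hinv δ s]
    exact (hhigh _ hδ).trans (le_max_right _ _)
  · push Not at hex
    rw [truncation_apply_eq_self_of_forall_borelHeight_le ν 𝓕 φ hex]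
    have hsT : borelHeight s ≤ T := by simpa using hex 1
    exact (hlow s hs hsT).trans (le_max_left _ _)

/-- **Families**: if the four hypotheses hold with the SAME constants `M₀`, `M₁` for every parameter `z ∈ Z`, the bound `max M₀ M₁` holds for every `z ∈ Z` — local
uniformity in the spectral parameter is inherited verbatim (input of R6g). [cite: MoeglinWaldspurger1995, IV.2] -/
theorem norm_truncation_le_of_cover_family {ι : Type*} {Z : Set ι} {ν : Measure (adelicUnipotent F E c N)} {𝓕 : Set (adelicUnipotent F E c N)} {T : ℝ≥0}
    {φ : ι → (quasiSplit F E c N).Adelic → ℂ} {𝔖 : Set (quasiSplit F E c N).Adelic} {M₀ M₁ : ℝ}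
    (hcov : ((quasiSplit F E c N).arithmeticSubgroup : Set (quasiSplit F E c N).Adelic) * 𝔖 = Set.univ)
    (hinv : ∀ z ∈ Z, ∀ (γ : (quasiSplit F E c N).arithmeticSubgroup) (g : (quasiSplit F E c N).Adelic),
      truncation ν 𝓕 T (φ z) ((γ : (quasiSplit F E c N).Adelic) * g) = truncation ν 𝓕 T (φ z) g)
    (hlow : ∀ z ∈ Z, ∀ s ∈ 𝔖, borelHeight s ≤ T → ‖φ z s‖ ≤ M₀)
    (hhigh : ∀ z ∈ Z, ∀ g : (quasiSplit F E c N).Adelic, T < borelHeight g → ‖truncation ν 𝓕 T (φ z) g‖ ≤ M₁) :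
    ∀ z ∈ Z, ∀ g : (quasiSplit F E c N).Adelic, ‖truncation ν 𝓕 T (φ z) g‖ ≤ max M₀ M₁ :=
  fun z hz g => norm_truncation_le_of_cover hcov (hinv z hz) (hlow z hz) (hhigh z hz) g

end CaseSplit

/-! ## §2 Discharges of `hlow` -/

section Low

/-- `hlow` from CONTINUITY ON A COMPACT SET containing the low part `𝔖 ∩ {H ≤ T}` (Mathlib `IsCompact.exists_bound_of_continuousOn`).
[cite: MoeglinWaldspurger1995, I.2.13] -/
theorem exists_bound_low_of_isCompact {T : ℝ≥0} {φ : (quasiSplit F E c N).Adelic → ℂ} {𝔖 C : Set (quasiSplit F E c N).Adelic} (hC : IsCompact C)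
    (hsub : ∀ s ∈ 𝔖, borelHeight s ≤ T → s ∈ C) (hcont : ContinuousOn φ C) :
    ∃ M₀ : ℝ, ∀ s ∈ 𝔖, borelHeight s ≤ T → ‖φ s‖ ≤ M₀ := by
  obtain ⟨M₀, hM₀⟩ := hC.exists_bound_of_continuousOn hcont
  exact ⟨M₀, fun s hs hsT => hM₀ s (hsub s hs hsT)⟩

omit [NeZero N] in
/-- `hlow` from MODERATE GROWTH on `𝔖`: `‖φ s‖ ≤ A·H(s)^n` on `𝔖` (`A ≥ 0`) gives `‖φ s‖ ≤ A·T^n` on `𝔖 ∩ {H ≤ T}`. [cite: MoeglinWaldspurger1995, I.2.3 and I.2.13] -/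
theorem exists_bound_low_of_moderateGrowth [NeZero N] {T : ℝ≥0} {φ : (quasiSplit F E c N).Adelic → ℂ} {𝔖 : Set (quasiSplit F E c N).Adelic} {A : ℝ} {n : ℕ}
    (hA : 0 ≤ A) (hmod : ∀ s ∈ 𝔖, ‖φ s‖ ≤ A * ((borelHeight s : ℝ≥0) : ℝ) ^ n) :
    ∀ s ∈ 𝔖, borelHeight s ≤ T → ‖φ s‖ ≤ A * (T : ℝ) ^ n := by
  intro s hs hsT
  refine (hmod s hs).trans (mul_le_mul_of_nonneg_left ?_ hA)
  exact pow_le_pow_left₀ (NNReal.coe_nonneg _) (NNReal.coe_le_coe.2 hsT) n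

end Low

/-! ## §3 `F`-rank one: discharges of `hinv` and `hhigh` for left-`G(F)`-invariant `φ` -/

section RankOne

variable [MeasurableSpace (adelicUnipotent F E c N)] [BorelSpace (adelicUnipotent F E c N)]

omit [MeasurableSpace (adelicUnipotent F E c N)] [BorelSpace (adelicUnipotent F E c N)] in
/-- **No non-Borel translate of a high point is high** (`N`-generic under the rank-one big cell `hSiegel`): `γ ∈ G(F) ∖ B(F)`, `1 ≤ T < H(g)` ⟹ `¬ T < H(γ g)`
(else `1 ≤ T² < H(γ g)·H(g) ≤ 1`).  `N`-generic form of ★ `not_lt_borelHeight_mul_of_not_mem_arithmeticBorel`. [cite: Garrett2018, §1.5 and §2.3] -/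
theorem not_lt_borelHeight_mul_of_siegel
    (hSiegel : ∀ γ : (quasiSplit F E c N).arithmeticSubgroup, γ ∉ arithmeticBorel F E c N →
      ∀ g : (quasiSplit F E c N).Adelic, borelHeight ((γ : (quasiSplit F E c N).Adelic) * g) * borelHeight g ≤ 1)
    {γ : (quasiSplit F E c N).arithmeticSubgroup} (hγ : γ ∉ arithmeticBorel F E c N) {T : ℝ≥0} (hT : 1 ≤ T) {g : (quasiSplit F E c N).Adelic}
    (hg : T < borelHeight g) : ¬T < borelHeight ((γ : (quasiSplit F E c N).Adelic) * g) := by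
  intro hγg
  have h1 := hSiegel γ hγ g
  have hT0 : 0 < T := lt_of_lt_of_le one_pos hT
  have h2 : T * T < borelHeight ((γ : (quasiSplit F E c N).Adelic) * g) * borelHeight g := mul_lt_mul'' hγg hg hT0.le hT0.le
  have h3 : (1 : ℝ≥0) ≤ T * T := one_le_mul_of_one_le_of_one_le hT hT
  exact absurd (h3.trans_lt (h2.trans_le h1)) (lt_irrefl 1)

/-- **High in the cusp Arthur's truncation is `φ − φ_B`** (`N`-generic under `hSiegel`; ★ at `N = 3`, `2`): for left-`B(F)`-invariant `φ`, a Haar `ν`, a fundamental domain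
`𝓕` and `1 ≤ T < H(g)`: `Λ^T φ(g) = φ(g) − φ_B(g)` — only the coset `B(F)` survives in `Ψ(c_B^T φ)(g)` (★ `pseudoEisenstein_eq_self_of_forall_not_mem`,
★ `constantTermTail_rational_borel_mul`). [cite: Garrett2018, §2.10 (PDF p. 119)] [cite: MoeglinWaldspurger1995, I.2.13] -/
theorem truncation_eq_self_sub_borelConstantTerm_of_siegel
    (hSiegel : ∀ γ : (quasiSplit F E c N).arithmeticSubgroup, γ ∉ arithmeticBorel F E c N →
      ∀ g : (quasiSplit F E c N).Adelic, borelHeight ((γ : (quasiSplit F E c N).Adelic) * g) * borelHeight g ≤ 1)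
    (ν : Measure (adelicUnipotent F E c N)) [ν.IsHaarMeasure] {𝓕 : Set (adelicUnipotent F E c N)}
    (h𝓕 : IsFundamentalDomain (rationalUnipotent F E c N) 𝓕 ν) {φ : (quasiSplit F E c N).Adelic → ℂ}
    (hφ : ∀ b ∈ arithmeticBorel F E c N, ∀ x : (quasiSplit F E c N).Adelic, φ ((b : (quasiSplit F E c N).Adelic) * x) = φ x)
    {T : ℝ≥0} (hT : 1 ≤ T) {g : (quasiSplit F E c N).Adelic} (hg : T < borelHeight g) :
    truncation ν 𝓕 T φ g = φ g - borelConstantTerm ν 𝓕 φ g := by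
  rw [truncation_def,
    pseudoEisenstein_eq_self_of_forall_not_mem (constantTermTail_rational_borel_mul ν h𝓕 T hφ) g
      (fun γ hγ => constantTermTail_of_not_lt φ (not_lt_borelHeight_mul_of_siegel hSiegel hγ hT hg)),
    constantTermTail_of_lt φ hg]

/-- **`‖Λ^T φ‖ ≤ max M₀ M₁` FOR LEFT-`G(F)`-INVARIANT `φ` IN `F`-RANK ONE** (`N`-generic under `hSiegel`): reduction theory `hcov`, a low bound `hlow` on the Siegel-type set,
and a bound `hdec` for `φ − φ_B` on the Siegel region `{H > T}` (`1 ≤ T`) — `hinv` by ★ `truncation_rational_mul`, `hhigh` by `truncation_eq_self_sub_borelConstantTerm_of_siegel`.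
[cite: MoeglinWaldspurger1995, I.2.13] [cite: Garrett2018, §2.10–§2.11] -/
theorem norm_truncation_le_of_rational_invariant
    (hSiegel : ∀ γ : (quasiSplit F E c N).arithmeticSubgroup, γ ∉ arithmeticBorel F E c N →
      ∀ g : (quasiSplit F E c N).Adelic, borelHeight ((γ : (quasiSplit F E c N).Adelic) * g) * borelHeight g ≤ 1)
    (ν : Measure (adelicUnipotent F E c N)) [ν.IsHaarMeasure] {𝓕 : Set (adelicUnipotent F E c N)}
    (h𝓕 : IsFundamentalDomain (rationalUnipotent F E c N) 𝓕 ν) {T : ℝ≥0} (hT : 1 ≤ T) {φ : (quasiSplit F E c N).Adelic → ℂ}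
    (hφ : ∀ (γ : (quasiSplit F E c N).arithmeticSubgroup) (x : (quasiSplit F E c N).Adelic), φ ((γ : (quasiSplit F E c N).Adelic) * x) = φ x)
    {𝔖 : Set (quasiSplit F E c N).Adelic} {M₀ M₁ : ℝ}
    (hcov : ((quasiSplit F E c N).arithmeticSubgroup : Set (quasiSplit F E c N).Adelic) * 𝔖 = Set.univ)
    (hlow : ∀ s ∈ 𝔖, borelHeight s ≤ T → ‖φ s‖ ≤ M₀)
    (hdec : ∀ g : (quasiSplit F E c N).Adelic, T < borelHeight g → ‖φ g - borelConstantTerm ν 𝓕 φ g‖ ≤ M₁)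
    (g : (quasiSplit F E c N).Adelic) : ‖truncation ν 𝓕 T φ g‖ ≤ max M₀ M₁ :=
  norm_truncation_le_of_cover hcov (truncation_rational_mul ν h𝓕 T hφ) hlow
    (fun g hg => by rw [truncation_eq_self_sub_borelConstantTerm_of_siegel hSiegel ν h𝓕 (fun b _ x => hφ b x) hT hg]; exact hdec g hg) g

end RankOne

section Instances

/-- **`U(J₃)`**: `‖Λ^T φ‖ ≤ max M₀ M₁` for left-`G(F)`-invariant `φ`, `1 ≤ T` (`hSiegel` = ★ `borelHeight_mul_borelHeight_le_one_of_not_mem_arithmeticBorel`).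
[cite: MoeglinWaldspurger1995, I.2.13] [cite: Garrett2018, §2.10–§2.11] -/
theorem norm_truncation_le_of_rational_invariant_three {F E : Type} [Field F] [NumberField F] [Field E] [NumberField E] [Algebra F E] {c : E ≃ₐ[F] E}
    [MeasurableSpace (adelicUnipotent F E c 3)] [BorelSpace (adelicUnipotent F E c 3)]
    (ν : Measure (adelicUnipotent F E c 3)) [ν.IsHaarMeasure] {𝓕 : Set (adelicUnipotent F E c 3)}
    (h𝓕 : IsFundamentalDomain (rationalUnipotent F E c 3) 𝓕 ν) {T : ℝ≥0} (hT : 1 ≤ T) {φ : (quasiSplit F E c 3).Adelic → ℂ}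
    (hφ : ∀ (γ : (quasiSplit F E c 3).arithmeticSubgroup) (x : (quasiSplit F E c 3).Adelic), φ ((γ : (quasiSplit F E c 3).Adelic) * x) = φ x)
    {𝔖 : Set (quasiSplit F E c 3).Adelic} {M₀ M₁ : ℝ}
    (hcov : ((quasiSplit F E c 3).arithmeticSubgroup : Set (quasiSplit F E c 3).Adelic) * 𝔖 = Set.univ)
    (hlow : ∀ s ∈ 𝔖, borelHeight s ≤ T → ‖φ s‖ ≤ M₀)
    (hdec : ∀ g : (quasiSplit F E c 3).Adelic, T < borelHeight g → ‖φ g - borelConstantTerm ν 𝓕 φ g‖ ≤ M₁)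
    (g : (quasiSplit F E c 3).Adelic) : ‖truncation ν 𝓕 T φ g‖ ≤ max M₀ M₁ :=
  norm_truncation_le_of_rational_invariant (fun _ hγ g => borelHeight_mul_borelHeight_le_one_of_not_mem_arithmeticBorel hγ g) ν h𝓕 hT hφ hcov hlow hdec g

/-- **`U(J₂)`**: the same (`hSiegel` = ★ `borelHeight_mul_borelHeight_le_one_of_not_mem_arithmeticBorel_two`). [cite: MoeglinWaldspurger1995, I.2.13] [cite: Garrett2018, §2.10–§2.11] -/
theorem norm_truncation_le_of_rational_invariant_two {F E : Type} [Field F] [NumberField F] [Field E] [NumberField E] [Algebra F E] {c : E ≃ₐ[F] E}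
    [MeasurableSpace (adelicUnipotent F E c 2)] [BorelSpace (adelicUnipotent F E c 2)]
    (ν : Measure (adelicUnipotent F E c 2)) [ν.IsHaarMeasure] {𝓕 : Set (adelicUnipotent F E c 2)}
    (h𝓕 : IsFundamentalDomain (rationalUnipotent F E c 2) 𝓕 ν) {T : ℝ≥0} (hT : 1 ≤ T) {φ : (quasiSplit F E c 2).Adelic → ℂ}
    (hφ : ∀ (γ : (quasiSplit F E c 2).arithmeticSubgroup) (x : (quasiSplit F E c 2).Adelic), φ ((γ : (quasiSplit F E c 2).Adelic) * x) = φ x)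
    {𝔖 : Set (quasiSplit F E c 2).Adelic} {M₀ M₁ : ℝ}
    (hcov : ((quasiSplit F E c 2).arithmeticSubgroup : Set (quasiSplit F E c 2).Adelic) * 𝔖 = Set.univ)
    (hlow : ∀ s ∈ 𝔖, borelHeight s ≤ T → ‖φ s‖ ≤ M₀)
    (hdec : ∀ g : (quasiSplit F E c 2).Adelic, T < borelHeight g → ‖φ g - borelConstantTerm ν 𝓕 φ g‖ ≤ M₁)
    (g : (quasiSplit F E c 2).Adelic) : ‖truncation ν 𝓕 T φ g‖ ≤ max M₀ M₁ :=
  norm_truncation_le_of_rational_invariant (fun _ hγ g => borelHeight_mul_borelHeight_le_one_of_not_mem_arithmeticBorel_two hγ g) ν h𝓕 hT hφ hcov hlow hdec g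

end Instances

/-! ## §4 `L²` (indeed every `L^p`) on the automorphic quotient -/

section LTwo

/-- **A bounded function with a.e.-strongly measurable descent is in every `L^p` of a finite measure on the automorphic quotient** (descent `[g] ↦ ψ(g̃⁻¹)` =
★ `AdelicGroupData.quotFun`; Mathlib `MemLp.of_bound`).  Any adelic group datum. [cite: MoeglinWaldspurger1995, I.2.13 and IV.2] -/
theorem memLp_quotFun_of_bound {K : Type} [Field K] [NumberField K] (𝒢 : AdelicGroupData K) (μ : Measure 𝒢.automorphicQuotient) [IsFiniteMeasure μ]
    (p : ℝ≥0∞) {ψ : 𝒢.Adelic → ℂ} {M : ℝ} (hbd : ∀ g : 𝒢.Adelic, ‖ψ g‖ ≤ M) (hmeas : AEStronglyMeasurable (𝒢.quotFun ψ) μ) :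
    MemLp (𝒢.quotFun ψ) p μ :=
  MemLp.of_bound hmeas M (ae_of_all _ fun x => AdelicGroupData.norm_quotFun_le hbd x)

/-- In particular bounded + measurable descent ⟹ integrable on the automorphic quotient (finite measure). [cite: MoeglinWaldspurger1995, I.2.13] -/
theorem integrable_quotFun_of_bound {K : Type} [Field K] [NumberField K] (𝒢 : AdelicGroupData K) (μ : Measure 𝒢.automorphicQuotient) [IsFiniteMeasure μ]
    {ψ : 𝒢.Adelic → ℂ} {M : ℝ} (hbd : ∀ g : 𝒢.Adelic, ‖ψ g‖ ≤ M) (hmeas : AEStronglyMeasurable (𝒢.quotFun ψ) μ) :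
    Integrable (𝒢.quotFun ψ) μ :=
  (memLp_quotFun_of_bound 𝒢 μ 1 hbd hmeas).integrable le_rfl

variable [MeasurableSpace (quasiSplit F E c N).Adelic] [BorelSpace (quasiSplit F E c N).Adelic]

omit [NeZero N] in
/-- **Borel descent** (`N`-generic form of ★ `measurable_quotFun_truncatedKernel`): a Borel, left-`G(F)`-invariant `ψ` on `U(J_N)(𝔸_F)` has Borel descent `[g] ↦ ψ(g̃⁻¹)` on the
automorphic quotient (★ `measurable_quotient_iff` along the closed `G(F)`, ★ `isClosed_quotientSubgroup_quasiSplit`, ★ `AdelicGroupData.quotFun_toAutomorphicQuotient`).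
[cite: MoeglinWaldspurger1995, I.2.13] -/
theorem measurable_quotFun_of_measurable {ψ : (quasiSplit F E c N).Adelic → ℂ} (hψm : Measurable ψ)
    (hψ : ∀ (γ : (quasiSplit F E c N).arithmeticSubgroup) (x : (quasiSplit F E c N).Adelic), ψ ((γ : (quasiSplit F E c N).Adelic) * x) = ψ x) :
    Measurable ((quasiSplit F E c N).quotFun ψ) := by
  haveI := secondCountableTopology_adeleRing E
  haveI := locallyCompactSpace_adeleRing' E
  haveI : T2Space (quasiSplit F E c N).Adelic := inferInstanceAs (T2Space (adelic F E c N ((StdForm.antidiagonal N).over E)))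
  haveI : LocallyCompactSpace (quasiSplit F E c N).Adelic := inferInstanceAs (LocallyCompactSpace (adelic F E c N ((StdForm.antidiagonal N).over E)))
  haveI : SecondCountableTopology (quasiSplit F E c N).Adelic :=
    inferInstanceAs (SecondCountableTopology (adelic F E c N ((StdForm.antidiagonal N).over E)))
  letI : MeasurableSpace ((quasiSplit F E c N).Adelic ⧸ (quasiSplit F E c N).quotientSubgroup) := (quasiSplit F E c N).instMeasurableSpaceAutomorphicQuotient
  haveI : BorelSpace ((quasiSplit F E c N).Adelic ⧸ (quasiSplit F E c N).quotientSubgroup) := (quasiSplit F E c N).instBorelSpaceAutomorphicQuotient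
  have hmeas := (Literature.MeasureTheory.Group.measurable_quotient_iff (G := (quasiSplit F E c N).Adelic) (H := (quasiSplit F E c N).quotientSubgroup)
    isClosed_quotientSubgroup_quasiSplit (F := (quasiSplit F E c N).quotFun ψ)).2
  have hinv : ∀ γ ∈ (quasiSplit F E c N).quotientSubgroup, ∀ g : (quasiSplit F E c N).Adelic, ψ (γ * g) = ψ g := by
    intro γ hγ g
    rw [quotientSubgroup_quasiSplit] at hγ
    exact hψ ⟨γ, hγ⟩ g
  have heq : (quasiSplit F E c N).quotFun ψ ∘ (QuotientGroup.mk : (quasiSplit F E c N).Adelic → (quasiSplit F E c N).Adelic ⧸ (quasiSplit F E c N).quotientSubgroup) =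
      fun g => ψ g⁻¹ := by
    funext g
    exact AdelicGroupData.quotFun_toAutomorphicQuotient hinv g
  exact hmeas (heq ▸ hψm.comp measurable_inv)

variable [MeasurableSpace (adelicUnipotent F E c N)] [BorelSpace (adelicUnipotent F E c N)]

/-- **`Λ^T φ ∈ L²(G(F)∖G(𝔸))`** for left-`G(F)`-invariant `φ` in `F`-rank one (`N`-generic under `hSiegel`), every finite (e.g. automorphic) measure `μ` on the quotient:
reduction theory `hcov` + low bound `hlow` + Siegel-region bound `hdec` for `φ − φ_B` + Borel measurability of `Λ^T φ` on `G(𝔸)` (`hmeasT`). [cite: MoeglinWaldspurger1995, I.2.13 and IV.2]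
[cite: Garrett2018, §2.10–§2.11] -/
theorem memLp_two_quotFun_truncation_of_rational_invariant
    (hSiegel : ∀ γ : (quasiSplit F E c N).arithmeticSubgroup, γ ∉ arithmeticBorel F E c N →
      ∀ g : (quasiSplit F E c N).Adelic, borelHeight ((γ : (quasiSplit F E c N).Adelic) * g) * borelHeight g ≤ 1)
    (ν : Measure (adelicUnipotent F E c N)) [ν.IsHaarMeasure] {𝓕 : Set (adelicUnipotent F E c N)}
    (h𝓕 : IsFundamentalDomain (rationalUnipotent F E c N) 𝓕 ν) {T : ℝ≥0} (hT : 1 ≤ T) {φ : (quasiSplit F E c N).Adelic → ℂ}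
    (hφ : ∀ (γ : (quasiSplit F E c N).arithmeticSubgroup) (x : (quasiSplit F E c N).Adelic), φ ((γ : (quasiSplit F E c N).Adelic) * x) = φ x)
    {𝔖 : Set (quasiSplit F E c N).Adelic} {M₀ M₁ : ℝ}
    (hcov : ((quasiSplit F E c N).arithmeticSubgroup : Set (quasiSplit F E c N).Adelic) * 𝔖 = Set.univ)
    (hlow : ∀ s ∈ 𝔖, borelHeight s ≤ T → ‖φ s‖ ≤ M₀)
    (hdec : ∀ g : (quasiSplit F E c N).Adelic, T < borelHeight g → ‖φ g - borelConstantTerm ν 𝓕 φ g‖ ≤ M₁)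
    (hmeasT : Measurable (truncation ν 𝓕 T φ))
    (μ : Measure (quasiSplit F E c N).automorphicQuotient) [IsFiniteMeasure μ] :
    MemLp ((quasiSplit F E c N).quotFun (truncation ν 𝓕 T φ)) 2 μ :=
  memLp_quotFun_of_bound (quasiSplit F E c N) μ 2 (norm_truncation_le_of_rational_invariant hSiegel ν h𝓕 hT hφ hcov hlow hdec)
    (measurable_quotFun_of_measurable hmeasT (truncation_rational_mul ν h𝓕 T hφ)).aestronglyMeasurable

end LTwo

end Summit.HodgeConjecture.HodgeConjecture.Cruxes.H413.K2E1TruncatedEisensteinL2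

end
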